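import Summits.NavierStokesRegularity.FluidComputer.PalasekTowerRegisterGlobalTail
import Summits.NavierStokesRegularity.FluidComputer.PalasekTowerRegisterWindow
import Literature.Analysis.FluidPDE.ClassicalSolutionGlue
import Literature.Analysis.Calculus.SeeleyExtension

/-!
# REGISTER v2.3′: the heredity WITNESS — one level of the tower reduced to a typed certificate of the design's own flow

Cell `ns-blowup`, seat `ns-blowup-ecbridge-6` (D-0074 GROUP C «BRIDGE SUPPORT»; bears_on LADDER-NS N1,
route `PalasekTowerBreakdown`, crux item stmt-NavierStokesRegularity-19178 `EpisodeInduction` =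
`EpisodeInductionG`, BC3 stub `heredity_at_one : HeredityAtOne`; base item stmt-…-19179 `EpisodeBase`
= `RungG 1`). Companions: `PalasekTowerRegisterGlobal.lean` (p411629: the items of record),
`PalasekTowerRegisterGlobalTail.lean` (p412736: `RungG`), `PalasekTowerHeredityWitnessRungs.lean`
(this seat: the K2G / rung / base corollaries and the numbers of record) and
`PalasekTowerHeredityAtOneWitness.lean` (this seat: the by-name corollaries on p415576's `HeredityAt`,
`HeredityAtOne`, `HeredityFrom`). LABEL: E–C typing (KERNEL vocabulary: one schedule-level predicate,
one NAMED open `Prop` per level, every implication proved). WHAT THIS IS NOT: not Navier–Stokes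
evidence — no stage, flow or tower is constructed; `HeredityWitness k` is a HYPOTHESIS that numerical
(MODEL) «tower words» may be booked against as analogues, never the crux; nothing here asserts it.

## What is typed, and why this shape

K2G asks, level by level, that every globally anchored registered stage at level `k` of a pinned
rigid quiet design extends to one at level `k + 1` — in the register's language (`Stage`, margins,
anchor, quiet clauses, a pressure gauge inherited along `Stage.Extends`). A numerical certificate of
ONE design `S = (u₀, f, τ, radius, …)` speaks another: «the classical finite-energy flow of `(u₀, f)`
exists up to `τ (k+1)`, its speed stays below `c₂ Y_{k+1}` on the growth window `[τ k, τ (k+1)]`, and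
at `τ (k+1)` the ball `B̄(0, radius)` shows a point of speed `≥ c₁ Y_{k+1}`, a point of strain
`≥ c₁ A_{k+1}` and a `C¹` loop of speed `≤ 8π/N_{k+1}` inside a ball of radius `1/N_{k+1}` with
circulation `≥ c₁ N_{k+1}^{β-2}`» — `Schedule.LevelWitness S ν k` (§2; no `Stage`, no margin, no
anchor, no quiet clause, ANY pressure gauge; any rates, any viscosity). `HeredityWitness k` (§2)
asks such a witness, at unit viscosity on the wide-base rates, of every pinned rigid quiet design
THAT EARNED A REGISTERED STAGE AT LEVEL `k` (necessary premise: the zero design is pinned rigid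
quiet, `TowerRates.exists_registered_schedule`, and has no witness). §3: a registered stage one
level up IS a witness (free). §4, THE REDUCTION `Stage.nonempty_extends_of_levelWitness`: GIVEN
forced unconditional uniqueness `hU` (`tao_unconditional_uniqueness_velocity_forced`, Tao 2013
Cor. 11.4 with its force slot — the route's W14 binder via `.schwartzForce`), a level witness of a
design EXTENDS every registered stage of that design at that level (any rates, any `ν > 0`): the
witness flow IS the stage's velocity on `[0, τ k]` (`hU`; the Clay datum is `H¹`); the pressures
differ there by a function of time alone up to the endpoints (`pressure_gauge_eq_of_velocity_eq`),
which Seeley's extension theorem (tree, `Literature.Analysis.Calculus.Seeley.contDiffOn_extend`; here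
`exists_contDiffOn_Ici_extension`) continues smoothly past `τ k`, so the re-gauged witness agrees
with the stage in velocity AND pressure on `[0, τ k]`; the ceiling before `τ k` is the stage's
(`Y_k ≤ Y_{k+1}`); and `Stage.exists_extends_of_continuation` (the planner's BC3 composition for any
rates / viscosity; its wide unit-viscosity case is p415576's `Stage.nonempty_extends_of_continuation`)
assembles the level-`k+1` stage. Modulo `hU` the witness form is EQUIVALENT to the register form at
every level (companion files) — nothing weaker or stronger is substituted; the delta is the SHAPE.

Why the datum form and not an unforced-window IVP from the level-`k` state: a window-only witness
needs a CLOSED-junction concatenation of classical solutions at `τ k`; the tree glues only along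
open overlaps (`IsClassicalNSSolutionOn.glue`), i.e. through local well-posedness ACROSS `τ k`, and
at `k = 1` the junction `τ₁` ends the forced era (`Schedule.Quiet`), for which no forced local
classical existence on `ℝ³` is in the tree. The datum form needs no gluing and costs exactly `hU`.

References: S. Palasek, arXiv:2605.13827 §3.3–§4 [cite: Palasek2026ElementaryModel, §4];
T. Tao, Anal. PDE 6 (2013), Cor. 11.4 [cite: Tao2011, Cor. 11.4]; R. T. Seeley, Proc. AMS 15 (1964)
625–626 [cite: Seeley1964, Theorem].
-/

noncomputable section

namespace Summit.NavierStokesRegularity.FluidComputer.PalasekTowerClayBridge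

open Set MeasureTheory Filter Topology Function Real
open scoped ENNReal ContDiff NNReal
open Literature.Analysis.FluidPDE
open Summit.NavierStokesRegularity.NavierStokesRegularity

/-! ## §0 Two calculus lemmas: smooth extension of a gauge past an endpoint; pressure gauges -/

/-- **Smooth extension past the right endpoint of a closed interval** (Seeley 1964, through the
tree's `Literature.Analysis.Calculus.Seeley.contDiffOn_extend`, applied to `(σ, y) ↦ c (a - σ)` on
the slab `[0, a) × ℝ`): a function `C^∞` on `[0, a]`, `a > 0`, agrees on `[0, a]` with a function
`C^∞` on `[0, ∞)`. [cite: Seeley1964, Theorem] -/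
theorem exists_contDiffOn_Ici_extension {a : ℝ} (ha : 0 < a) {c : ℝ → ℝ}
    (hc : ContDiffOn ℝ ∞ c (Icc 0 a)) :
    ∃ e : ℝ → ℝ, ContDiffOn ℝ ∞ e (Ici 0) ∧ EqOn e c (Icc 0 a) := by
  -- reflect: `g (σ, y) = c (a - σ)` is smooth on the slab `[0, a) × ℝ`
  set g : ℝ × ℝ → ℝ := fun z => c (a - z.1) with hg
  have hφ : ContDiff ℝ ∞ (fun z : ℝ × ℝ => a - z.1) := contDiff_const.sub contDiff_fst
  have hgs : ContDiffOn ℝ ∞ g (Literature.Analysis.Calculus.Seeley.slab a (univ : Set ℝ)) := by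
    refine hc.comp hφ.contDiffOn ?_
    intro z hz
    have hz1 : z.1 ∈ Ico 0 a := hz.1
    exact ⟨by linarith [hz1.2], by linarith [hz1.1]⟩
  set G : ℝ × ℝ → ℝ := Literature.Analysis.Calculus.Seeley.extend a g with hG
  have hGs : ContDiffOn ℝ ∞ G (Iio a ×ˢ (univ : Set ℝ)) :=
    Literature.Analysis.Calculus.Seeley.contDiffOn_extend ha isOpen_univ hgs
  -- the extension `e t = G (a - t, 0)`
  refine ⟨fun t => G (a - t, 0), ?_, ?_⟩
  · -- agreement on `(-∞, a]`, in particular on `[0, a]`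
    have heq : ∀ t, t ≤ a → G (a - t, 0) = c t := by
      intro t ht
      have h0 : (0 : ℝ) ≤ (a - t, (0 : ℝ)).1 := by show (0 : ℝ) ≤ a - t; linarith
      rw [hG, Literature.Analysis.Calculus.Seeley.extend_of_nonneg h0, hg]
      simp only [sub_sub_cancel]
    intro t ht
    rcases (show (0 : ℝ) ≤ t from ht).eq_or_lt with h0 | hpos
    · -- at `t = 0`: `e = c` on `[0, a]`, a neighbourhood of `0` within `[0, ∞)`
      subst h0
      have hcw : ContDiffWithinAt ℝ ∞ c (Icc 0 a) 0 := hc 0 ⟨le_rfl, ha.le⟩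
      have hew : ContDiffWithinAt ℝ ∞ (fun t => G (a - t, 0)) (Icc 0 a) 0 :=
        hcw.congr (fun t ht => heq t ht.2) (heq 0 ha.le)
      exact hew.mono_of_mem_nhdsWithin (Icc_mem_nhdsGE ha)
    · -- at `t > 0`: `(a - t, 0)` lies in the open set `(-∞, a) × ℝ` where `G` is smooth
      have hmem : (a - t, (0 : ℝ)) ∈ Iio a ×ˢ (univ : Set ℝ) :=
        ⟨by simp only [mem_Iio]; linarith, mem_univ _⟩
      have hGat : ContDiffAt ℝ ∞ G (a - t, 0) :=
        hGs.contDiffAt ((isOpen_Iio.prod isOpen_univ).mem_nhds hmem)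
      have hψ : ContDiffAt ℝ ∞ (fun t : ℝ => (a - t, (0 : ℝ))) t :=
        ((contDiff_const.sub contDiff_id).prodMk contDiff_const).contDiffAt
      exact (hGat.comp t hψ).contDiffWithinAt
  · intro t ht
    have h0 : (0 : ℝ) ≤ (a - t, (0 : ℝ)).1 := by show (0 : ℝ) ≤ a - t; linarith [ht.2]
    show G (a - t, 0) = c t
    rw [hG, Literature.Analysis.Calculus.Seeley.extend_of_nonneg h0, hg]
    simp only [sub_sub_cancel]

/-- **Two classical solutions with the same velocity on a closed slab have pressures differing by a
function of time alone, up to the endpoints**: if `(u, p)` is classical on `[0, τ]` and `(v, q)` on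
`[0, τ']`, `0 < τ ≤ τ'` (same viscosity and force), with `v = u` on `[0, τ]`, then
`p t x - p t 0 = q t x - q t 0` for ALL `t ∈ [0, τ]` (interior times:
`IsClassicalNSSolutionOn.pressure_sub_apply_zero_eq_of_eventuallyEq`; the endpoints by continuity).
[folklore] -/
theorem pressure_gauge_eq_of_velocity_eq
    {E : Type*} [NormedAddCommGroup E] [InnerProductSpace ℝ E] [FiniteDimensional ℝ E]
    {τ τ' ν : ℝ} (hτ : 0 < τ) (hττ' : τ ≤ τ') {f u v : ℝ → E → E} {p q : ℝ → E → ℝ}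
    (hu : IsClassicalNSSolutionOn (Icc 0 τ) ν f u p)
    (hv : IsClassicalNSSolutionOn (Icc 0 τ') ν f v q) (heq : ∀ t ∈ Icc 0 τ, v t = u t) :
    ∀ t ∈ Icc 0 τ, ∀ x, p t x - p t 0 = q t x - q t 0 := by
  intro t ht x
  -- interior times
  have hint : EqOn (fun s => p s x - p s 0) (fun s => q s x - q s 0) (Ioo 0 τ) := by
    intro s hs
    have hev : ∀ᶠ r in 𝓝 s, u r = v r := by
      filter_upwards [Ioo_mem_nhds hs.1 hs.2] with r hr using (heq r ⟨hr.1.le, hr.2.le⟩).symm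
    exact hu.pressure_sub_apply_zero_eq_of_eventuallyEq hv (Icc_mem_nhds hs.1 hs.2)
      (Icc_mem_nhds hs.1 (hs.2.trans_le hττ')) hev x
  -- continuity in time of the two gauge-fixed pressures on the closed slab
  have hslice : ∀ {S : Set ℝ} {w : ℝ → E → ℝ}, IsSmoothSpaceTimeOn S w → ∀ y : E,
      ContinuousOn (fun s => w s y) S := by
    intro S w hw y
    have hc : Continuous (fun s : ℝ => ((s, y) : ℝ × E)) := continuous_id.prodMk continuous_const
    exact hw.continuousOn.comp hc.continuousOn (fun s hs => mk_mem_prod hs (mem_univ y))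
  have hpc : ContinuousOn (fun s => p s x - p s 0) (Icc 0 τ) :=
    (hslice hu.smooth_pressure x).sub (hslice hu.smooth_pressure 0)
  have hqc : ContinuousOn (fun s => q s x - q s 0) (Icc 0 τ) :=
    ((hslice hv.smooth_pressure x).sub (hslice hv.smooth_pressure 0)).mono
      (Icc_subset_Icc le_rfl hττ')
  have hcl : Icc 0 τ ⊆ closure (Ioo 0 τ) := by rw [closure_Ioo hτ.ne]
  exact hint.of_subset_closure hpc hqc Ioo_subset_Icc_self hcl ht

/-! ## §1 Two rate facts used by the reduction -/

/-- The velocity scales increase along the tower: `Y_k ≤ Y_{k+1}`. [folklore] -/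
theorem TowerRates.Y_le_Y_succ (R : TowerRates) (k : ℕ) : R.Y k ≤ R.Y (k + 1) :=
  (R.Y_lt_Y_succ k).le

/-- Under rigidity the growth window of level `k + 1` is a nonnegative length (any rates).
[folklore] -/
theorem Schedule.Rigid.window_nonneg {R : TowerRates} {S : Schedule R} (h : S.Rigid) (k : ℕ) :
    0 ≤ S.c₅ * Real.log (R.N (k + 1)) / R.A k :=
  (h.window_pos k).le

/-! ## §2 The level witness of a design and the heredity witness -/

/-- **The LEVEL WITNESS of a design at level `k`** (certificate shape; a predicate, never asserted of
any schedule here): the schedule's own classical flow — an exact classical solution `(v, q)` of the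
forced system with the design force `S.f` from the Clay datum `S.u₀` on the CLOSED slab
`[0, τ (k+1)]` at viscosity `ν`, with finite energy there — stays below the next ceiling `c₂ Y_{k+1}`
on the growth window `[τ k, τ (k+1)]` and shows at the readout `τ (k+1)`, inside the ball
`B̄(0, radius)`, the three floors of level `k + 1`: a point of speed `≥ c₁ Y_{k+1}`, a point of
velocity gradient `≥ c₁ A_{k+1}`, and a `C¹` closed loop of speed `≤ 8π/N_{k+1}` inside a ball of
radius `1/N_{k+1}` with circulation `≥ c₁ N_{k+1}^{β-2}`. No `Stage`, margin, anchor or quiet clause;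
any pressure gauge. This is the checklist a validated numerical run of the design `S` would certify
(HOME/cap/K1R-CAP-PRICE.md prices it: not purchasable on `ℝ³` with 2026 technology; MODEL tower words
are analogues, NOT instances). [cite: Palasek2026ElementaryModel, §4] -/
def Schedule.LevelWitness {R : TowerRates} (S : Schedule R) (ν : ℝ) (k : ℕ) : Prop :=
  ∃ (v : ℝ → EuclideanSpace ℝ (Fin 3) → EuclideanSpace ℝ (Fin 3))
    (q : ℝ → EuclideanSpace ℝ (Fin 3) → ℝ),
    IsClassicalNSSolutionOn (Icc 0 (S.τ (k + 1))) ν S.f v q ∧ v 0 = S.u₀ ∧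
    (∃ C : ℝ≥0∞, C < ⊤ ∧ ∀ t ∈ Icc 0 (S.τ (k + 1)), ∫⁻ x, ‖v t x‖ₑ ^ 2 ≤ C) ∧
    (∀ t ∈ Icc (S.τ k) (S.τ (k + 1)), ∀ x, ‖v t x‖ ≤ S.c₂ * R.Y (k + 1)) ∧
    (∃ x, ‖x‖ ≤ S.radius ∧ S.c₁ * R.Y (k + 1) ≤ ‖v (S.τ (k + 1)) x‖) ∧
    (∃ x, ‖x‖ ≤ S.radius ∧ S.c₁ * R.A (k + 1) ≤ ‖fderiv ℝ (v (S.τ (k + 1))) x‖) ∧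
    (∃ (x : EuclideanSpace ℝ (Fin 3)) (γ : ℝ → EuclideanSpace ℝ (Fin 3)),
      ‖x‖ ≤ S.radius ∧ ContDiff ℝ 1 γ ∧ γ 0 = γ 1 ∧
      (∀ σ ∈ Icc (0 : ℝ) 1, γ σ ∈ Metric.closedBall x (1 / R.N (k + 1))) ∧
      (∀ σ ∈ Icc (0 : ℝ) 1, ‖deriv γ σ‖ ≤ 8 * π / R.N (k + 1)) ∧
      S.c₁ * R.N (k + 1) ^ (R.β - 2) ≤ circulation (v (S.τ (k + 1))) γ)

/-- **The HEREDITY WITNESS at level `k`** (open for every `k`; never asserted; the TYPED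
numerical-witness hypothesis of the first-rung stub when `k = 1`, of the base's first episode when
`k = 0`): every pinned (`Λ = 8`, `θ = 6/5`), rigid, quiet design on the wide-base rates that EARNED a
globally anchored registered stage at level `k` at unit viscosity has a level witness at level `k` —
its own flow, continued classically with finite energy from the Clay datum under the design force,
reaches `τ (k+1)` below `c₂ Y_{k+1}` on the window and shows the three level-`k+1` floors there. At
`k = 1`: the hand-over `N₁ = 256^{1.1} ≈ 445 → N₂ ≈ 820` at level Reynolds number `N₁^{3/10} ≈ 6.2`,
window `(253/25) log N₂ / A₁`, no force after `τ 1`. [cite: Palasek2026ElementaryModel, §4] -/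
@[conjecture] def HeredityWitness (k : ℕ) : Prop :=
  ∀ S : Schedule TowerRates.wide, S.Pins 8 (6 / 5) → S.Rigid → S.Quiet →
    Nonempty (Stage 1 TowerRates.wide S (Margins.routeG TowerRates.wide) k) →
      S.LevelWitness 1 k

/-! ## §3 A stage one level up IS a level witness (free direction) -/

namespace Stage

variable {ν : ℝ} {R : TowerRates} {S : Schedule R} {k : ℕ}

/-- **A registered stage at level `k + 1` IS a level witness at level `k`** of its design (its own
velocity and pressure; the window ceiling is its level-`k+1` ceiling, the floors are its fields).
[folklore] -/
theorem levelWitness (s : Stage ν R S (Margins.routeG R) (k + 1)) : S.LevelWitness ν k := by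
  refine ⟨s.u, s.p, s.classical, s.initial, s.energy, ?_, s.floor (k + 1) le_rfl,
    s.routeG_strain (k + 1) le_rfl, s.routeG_coreLedger (k + 1) le_rfl⟩
  intro t ht x
  exact s.ceiling (k + 1) le_rfl t ⟨(S.τ_pos k).le.trans ht.1, ht.2⟩ x

/-! ## §4 The reduction: a level witness extends every registered stage of its design (given `hU`) -/

/-- **Assembling a stage at level `k + 1` from a continuation** (any rates, any viscosity; the
planner's BC3 composition `EpisodeInductionG_of`, whose wide unit-viscosity case is p415576's
`Stage.nonempty_extends_of_continuation`): a classical finite-energy continuation of a globally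
anchored registered stage to `τ (k+1)` with the SAME pressure on `[0, τ k]`, inside the next ceiling
and meeting the three floors of level `k + 1` at `τ (k+1)`, IS a registered stage at level `k + 1`
extending it — earlier floors / ceilings / quiet clauses / strain floors / core loops are read off the
old stage through the agreement on `[0, τ k]`, the new quiet clause is the old top ceiling by window
equality, rigidity is schedule data, and the global anchor (a `[0, τ 0)` clause) is inherited.
[folklore] -/
theorem exists_extends_of_continuation (hrig : S.Rigid) (s : Stage ν R S (Margins.routeG R) k)
    {u : ℝ → EuclideanSpace ℝ (Fin 3) → EuclideanSpace ℝ (Fin 3)}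
    {p : ℝ → EuclideanSpace ℝ (Fin 3) → ℝ}
    (hcl : IsClassicalNSSolutionOn (Icc 0 (S.τ (k + 1))) ν S.f u p)
    (hagree : ∀ t ∈ Icc 0 (S.τ k), u t = s.u t ∧ p t = s.p t)
    (henergy : ∃ C : ℝ≥0∞, C < ⊤ ∧ ∀ t ∈ Icc 0 (S.τ (k + 1)), ∫⁻ x, ‖u t x‖ₑ ^ 2 ≤ C)
    (hceil : ∀ t ∈ Icc 0 (S.τ (k + 1)), ∀ x, ‖u t x‖ ≤ S.c₂ * R.Y (k + 1))
    (hfloor : ∃ x, ‖x‖ ≤ S.radius ∧ S.c₁ * R.Y (k + 1) ≤ ‖u (S.τ (k + 1)) x‖)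
    (hstrain : ∃ x, ‖x‖ ≤ S.radius ∧ S.c₁ * R.A (k + 1) ≤ ‖fderiv ℝ (u (S.τ (k + 1))) x‖)
    (hcore : ∃ (x : EuclideanSpace ℝ (Fin 3)) (γ : ℝ → EuclideanSpace ℝ (Fin 3)),
      ‖x‖ ≤ S.radius ∧ ContDiff ℝ 1 γ ∧ γ 0 = γ 1 ∧
      (∀ σ ∈ Icc (0 : ℝ) 1, γ σ ∈ Metric.closedBall x (1 / R.N (k + 1))) ∧
      (∀ σ ∈ Icc (0 : ℝ) 1, ‖deriv γ σ‖ ≤ 8 * π / R.N (k + 1)) ∧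
      S.c₁ * R.N (k + 1) ^ (R.β - 2) ≤ circulation (u (S.τ (k + 1))) γ) :
    ∃ s' : Stage ν R S (Margins.routeG R) (k + 1), s.Extends s' := by
  have hm : (∀ j, j ≤ k → ∃ x, ‖x‖ ≤ S.radius ∧ S.c₁ * R.A j ≤ ‖fderiv ℝ (s.u (S.τ j)) x‖) ∧
      (S.AnchorGlobal s.u ∧ (S.Rigid ∧ CoreLedger R S k s.u)) := s.margin
  obtain ⟨hstrain_old, hanch, -, hcore_old⟩ := hm
  -- agreement at the old readout times and on the old slab
  have hag : ∀ j, j ≤ k → u (S.τ j) = s.u (S.τ j) := fun j hj =>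
    (hagree (S.τ j) ⟨(S.τ_pos j).le, S.τ_mono hj⟩).1
  have hag' : ∀ t, t ∈ Icc 0 (S.τ k) → u t = s.u t := fun t ht => (hagree t ht).1
  refine ⟨{ u := u, p := p, classical := hcl, initial := ?_, energy := henergy, floor := ?_,
            ceiling := ?_, quiet := ?_, margin := ?_ }, fun t ht => hagree t ht⟩
  · -- initial
    rw [hag' 0 ⟨le_rfl, (S.τ_pos k).le⟩]
    exact s.initial
  · -- floors
    intro j hj
    rcases Nat.lt_or_ge j (k + 1) with h | h
    · have hjk : j ≤ k := Nat.lt_succ_iff.mp h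
      rw [hag j hjk]
      exact s.floor j hjk
    · have hj' : j = k + 1 := le_antisymm hj h
      subst hj'
      exact hfloor
  · -- ceilings
    intro j hj t ht x
    rcases Nat.lt_or_ge j (k + 1) with h | h
    · have hjk : j ≤ k := Nat.lt_succ_iff.mp h
      rw [hag' t ⟨ht.1, ht.2.trans (S.τ_mono hjk)⟩]
      exact s.ceiling j hjk t ht x
    · have hj' : j = k + 1 := le_antisymm hj h
      subst hj'
      exact hceil t ht x
  · -- quiet
    intro j hj t ht x
    rcases Nat.lt_or_ge (j + 1) (k + 1) with h | h
    · have hjk : j + 1 ≤ k := Nat.lt_succ_iff.mp h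
      have hw := hrig.window_nonneg j
      rw [hag' t ⟨ht.1, by linarith [ht.2, S.τ_mono hjk]⟩]
      exact s.quiet j hjk t ht x
    · have hj' : j = k := by omega
      subst hj'
      have ht' : t ∈ Icc 0 (S.τ j) := ⟨ht.1, by have := hrig.window_eq j; linarith [ht.2]⟩
      rw [hag' t ht']
      exact s.ceiling j le_rfl t ht' x
  · -- margin: strain floors ∧ (global anchor ∧ (rigidity ∧ core ledger)); the anchor is inherited
    show (∀ j, j ≤ k + 1 → ∃ x, ‖x‖ ≤ S.radius ∧ S.c₁ * R.A j ≤ ‖fderiv ℝ (u (S.τ j)) x‖) ∧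
      (S.AnchorGlobal u ∧ (S.Rigid ∧ CoreLedger R S (k + 1) u))
    refine ⟨?_, hanch.congr (k := k) hag', hrig, ?_⟩
    · intro j hj
      rcases Nat.lt_or_ge j (k + 1) with h | h
      · have hjk : j ≤ k := Nat.lt_succ_iff.mp h
        rw [hag j hjk]
        exact hstrain_old j hjk
      · have hj' : j = k + 1 := le_antisymm hj h
        subst hj'
        exact hstrain
    · intro j hj
      rcases Nat.lt_or_ge j (k + 1) with h | h
      · have hjk : j ≤ k := Nat.lt_succ_iff.mp h
        rw [hag j hjk]
        exact hcore_old j hjk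
      · have hj' : j = k + 1 := le_antisymm hj h
        subst hj'
        exact hcore

/-- **THE REDUCTION — a level witness extends every registered stage of its design (given `hU`,
any rates, any viscosity `ν > 0`).** Let `s` be a globally anchored registered stage at level `k` of
a schedule `S` and let `(v, q)` be a level witness of `S` at level `k` at the same viscosity. By forced
unconditional uniqueness (`hU`; the Clay datum is `H¹`, both flows are classical with finite energy)
`v = s.u` on `[0, τ k]`; the pressures then differ there by a function of time alone
(`pressure_gauge_eq_of_velocity_eq`), smooth on `[0, τ k]`, which extends smoothly past `τ k`
(`exists_contDiffOn_Ici_extension`, Seeley); re-gauging `q` by it gives a classical continuation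
agreeing with `s` in velocity AND pressure on `[0, τ k]`, below `c₂ Y_{k+1}` throughout (before `τ k`
by the stage's ceiling and `Y_k ≤ Y_{k+1}`), carrying the witness's floors — and
`exists_extends_of_continuation` assembles the level-`k+1` stage. [cite: Tao2011, Cor. 11.4] -/
theorem nonempty_extends_of_levelWitness (hU : tao_unconditional_uniqueness_velocity_forced)
    (hν : 0 < ν) (s : Stage ν R S (Margins.routeG R) k) (hW : S.LevelWitness ν k) :
    ∃ s' : Stage ν R S (Margins.routeG R) (k + 1), s.Extends s' := by
  obtain ⟨v, q, hcl, hv0, henergy, hceilW, hfloor, hstrain, hcore⟩ := hW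
  have hrig : S.Rigid := s.routeG_rigid
  have hτk : 0 < S.τ k := S.τ_pos k
  have hτle : S.τ k ≤ S.τ (k + 1) := S.τ_mono (Nat.le_succ k)
  -- (1) velocity: `v = s.u` on `[0, τ k]` by forced unconditional uniqueness
  have hclk : IsClassicalNSSolutionOn (Icc 0 (S.τ k)) ν S.f v q :=
    hcl.mono (Icc_subset_Icc le_rfl hτle) (uniqueDiffOn_Icc hτk)
  have hC1 : ContDiff ℝ 1 S.u₀ := s.contDiff_datum.of_le (by norm_cast)
  obtain ⟨hL2, hH1⟩ := Theorems.ClayUniqueness.memLp_two_of_rapidDecay S.datum_decay hC1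
  have hEv : ∃ C : ℝ≥0∞, C < ⊤ ∧ ∀ t ∈ Icc 0 (S.τ k), ∫⁻ x, ‖v t x‖ₑ ^ 2 ≤ C := by
    obtain ⟨C, hC, hb⟩ := henergy
    exact ⟨C, hC, fun t ht => hb t ⟨ht.1, ht.2.trans hτle⟩⟩
  have hvel : ∀ t ∈ Icc 0 (S.τ k), v t = s.u t :=
    hU ν (S.τ k) hν hτk S.u₀ hL2 hH1 S.f S.force_smooth S.force_decay v s.u q s.p hclk
      s.classical hv0 s.initial hEv s.energy
  -- (2) pressure gauge: `s.p t x - s.p t 0 = q t x - q t 0` on `[0, τ k]`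
  have hgauge : ∀ t ∈ Icc 0 (S.τ k), ∀ x, s.p t x - s.p t 0 = q t x - q t 0 :=
    pressure_gauge_eq_of_velocity_eq hτk hτle s.classical hcl hvel
  -- the gauge function `t ↦ s.p t 0 - q t 0`, smooth on `[0, τ k]`, extended past `τ k`
  have hslice0 : ∀ {T : ℝ} {w : ℝ → EuclideanSpace ℝ (Fin 3) → ℝ}, IsSmoothSpaceTimeOn (Icc 0 T) w →
      ContDiffOn ℝ ∞ (fun t => w t 0) (Icc 0 T) := by
    intro T w hw
    have hc : ContDiff ℝ ∞ (fun t : ℝ => ((t, (0 : EuclideanSpace ℝ (Fin 3))) :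
        ℝ × EuclideanSpace ℝ (Fin 3))) := contDiff_id.prodMk contDiff_const
    exact hw.comp hc.contDiffOn (fun t ht => mk_mem_prod ht (mem_univ _))
  have hc_smooth : ContDiffOn ℝ ∞ (fun t => s.p t 0 - q t 0) (Icc 0 (S.τ k)) :=
    (hslice0 s.classical.smooth_pressure).sub
      ((hslice0 hcl.smooth_pressure).mono (Icc_subset_Icc le_rfl hτle))
  obtain ⟨e, he, hec⟩ := exists_contDiffOn_Ici_extension hτk hc_smooth
  -- (3) the re-gauged pressure `P t x = q t x - (- e t)` and the continuation `(v, P)`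
  set P : ℝ → EuclideanSpace ℝ (Fin 3) → ℝ := fun t x => q t x - (-e t) with hP
  have hPcl : IsClassicalNSSolutionOn (Icc 0 (S.τ (k + 1))) ν S.f v P := by
    refine ⟨hcl.smooth_velocity, ?_, ?_, hcl.divFree⟩
    · -- joint smoothness of `q + e ∘ fst`
      have he' : ContDiffOn ℝ ∞ (fun z : ℝ × EuclideanSpace ℝ (Fin 3) => -e z.1)
          (Icc 0 (S.τ (k + 1)) ×ˢ univ) :=
        (he.comp contDiff_fst.contDiffOn (fun z hz => (hz.1 : z.1 ∈ Icc 0 (S.τ (k + 1))).1)).neg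
      exact ContDiffOn.sub hcl.smooth_pressure he'
    · intro t ht x
      have hg : gradient (P t) x = gradient (q t) x := gradient_sub_const (q t) (-e t) x
      rw [hg]
      exact hcl.momentum t ht x
  have hagree : ∀ t ∈ Icc 0 (S.τ k), v t = s.u t ∧ P t = s.p t := by
    intro t ht
    refine ⟨hvel t ht, funext fun x => ?_⟩
    have h1 := hgauge t ht x
    have h2 : e t = s.p t 0 - q t 0 := hec ht
    show q t x - (-e t) = s.p t x
    linarith
  -- (4) the ceiling on the whole slab
  have hceil : ∀ t ∈ Icc 0 (S.τ (k + 1)), ∀ x, ‖v t x‖ ≤ S.c₂ * R.Y (k + 1) := by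
    intro t ht x
    rcases le_or_gt t (S.τ k) with htk | htk
    · rw [hvel t ⟨ht.1, htk⟩]
      refine (s.ceiling k le_rfl t ⟨ht.1, htk⟩ x).trans ?_
      exact mul_le_mul_of_nonneg_left (R.Y_le_Y_succ k) s.c₂_pos.le
    · exact hceilW t ⟨htk.le, ht.2⟩ x
  exact s.exists_extends_of_continuation hrig hPcl hagree henergy hceil hfloor hstrain hcore

end Stage

end Summit.NavierStokesRegularity.FluidComputer.PalasekTowerClayBridge

end
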